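import Summits.QuantumFields.BalabanUV.Beta.DiagonalContact

/-!
# The diagonal contact is a LOCALISED STENCIL: entry bounds, finite range and the socket `hC` of the coarse wiring for
# `C 0 α κ′ u := c • diagK (ctGen d α Lc κ′ u)` (β sub-cell, row BETA-an2, gen 14; NOTE X-an2-45 §3 / (R45-4))

HONEST FRAMING (cell charter, verbatim): «discharging BetaPertH makes Balaban's UV stability UNCONDITIONAL — a real
constructive-QFT result; it is NOT the continuum limit and NOT the Clay problem.»  DERIVED cell leaf (pub-balaban β sub-cell, lane
an2 gen 14); no statement of Bałaban's papers is typed here, no `[cite:]` tag, no `Prop` fact; it instantiates no binder of the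
β-function wall by itself.  NOT `BetaPertH`; NOT continuum; NOT Clay.

## What is here ([folklore] bookkeeping over `DiagonalContact` / `BorderedHessianRooted`)

* `abs_ctGen_inl_le` (`≤ 1`), `abs_ctGen_inr_le` (`≤ ell (d+1) L`), `abs_ctGen_le` (`≤ 1 + ell (d+1) L`);
* FINITE RANGE `ctGen_eq_zero_of_not_mem_cube`: the generator at the jet bond `(κ′, u)` vanishes at every leg `x` with `u − x ∉ cube (2L)`;
* `biLoc_diagK_ctGen`: `BiLoc (diagK (ctGen d α L κ′ u)) u u ((1 + ell (d+1) L)·e^{δ(d+1)4L}) δ` for every `δ ≥ 0`;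
* **`locStencil_smul_diagK_ctGen`**: `LocStencil (fun κ′ u => c • diagK (ctGen d α L κ′ u)) (|c|·(1 + ell (d+1) L)·e^{δ(d+1)4L}) δ` — the
  socket `hC` of `SpineRooted.axisReflectionCovariant_flipK_TbalOf_JsBalBmAtOf_ctrC` (and of its native twin) for the `j = 0` contact family
  `C 0 α κ′ u := (cVH / Lc^{d+1}) • diagK (ctGen d α Lc κ′ u)` of `VhPieceReflection` / `S0NReflection`, with any `δ > 0`.

All declarations `[folklore]`; axioms standard.  Provenance: b2b-balaban β sub-cell, unit beta-an2 gen 14, 2026-08-20 (v1); over `DiagonalContact` BY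
NAME; no existing file touched.
-/

open Finset
open scoped BigOperators
open Literature.Probability.LatticeModels (TorusSite Torus.proj Torus.proj_apply)
open Literature.MathematicalPhysics.QuantumFieldTheory
open Literature.MathematicalPhysics.QuantumFieldTheory.Balaban1983to89
open Literature.MathematicalPhysics.QuantumFieldTheory.Balaban1983to89.Beta
open B12Sec2to5 (l1 l1_nonneg)
open ExpKernelCalculus (MKer Decays BiLoc comp)
open AffineAveraging (box toSite)
open AveragingContours (blk off)
open AveragingContoursRooted (ctr ctrOff ctrOff_mem_box linAvgAt)
open AveragingHessianKernels (Bond Near ell)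
open AveragingHessianKernelsRooted (linCountAt linKerAt)
open KKTFluctuationKernel (delta1)
open LatticeForm (quo)
open OneStepResolventKernel (Fib LocStencil)
open Summit.QuantumFields.BalabanUV.Beta.TameKernelCalculus
open Summit.QuantumFields.BalabanUV.Beta.AxialDressingRooted (cube mem_cube l1_le_of_mem_cube one_le_of_neZero)

namespace Summit.QuantumFields.BalabanUV.Beta.BorderedHessian

noncomputable section

variable {d : ℕ} (α : Fin (d + 1)) (L : ℕ) (κ' : Fin (d + 1)) (u : Fin (d + 1) → ℤ)

/-- [folklore] Field-leg entries of the generator are bounded by `1`. -/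
theorem abs_ctGen_inl_le (x : Fin (d + 1) → ℤ) (β : Fin (d + 1)) : |ctGen d α L κ' u x (Sum.inl β)| ≤ 1 := by
  rw [ctGen_inl]
  split_ifs
  · rw [abs_neg, abs_one]
  · rw [abs_zero]; exact zero_le_one

/-- [folklore] Multiplier-leg entries of the generator are bounded by `ell (d+1) L` (`L ≥ 1`). -/
theorem abs_ctGen_inr_le [NeZero L] (z : Fin (d + 1) → ℤ) (μ : Fin (d + 1)) : |ctGen d α L κ' u z (Sum.inr μ)| ≤ ell (d + 1) L := by
  rw [ctGen_inr]
  split_ifs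
  · rw [abs_neg]
    have hL : (0 : ℝ) < (L : ℝ) ^ (d + 1) := by
      have : (0 : ℝ) < L := by exact_mod_cast Nat.pos_of_ne_zero (NeZero.ne L)
      positivity
    have e := linAvgAt_delta1_eq_pow_mul_linKerAt (L := L) (ctr (d + 1) L) κ' u μ (blk L z)
    have hb := abs_linAvgAt_delta1_le (d := d) (one_le_of_neZero L) (ctrOff_mem_box (one_le_of_neZero L)) κ' u μ (blk L z)
    rw [AveragingContoursRooted.ctr] at e
    rw [e, abs_mul, abs_of_pos hL] at hb
    exact le_of_mul_le_mul_left hb hL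
  · rw [abs_zero]; positivity

/-- [folklore] Every entry of the generator is bounded by `1 + ell (d+1) L`. -/
theorem abs_ctGen_le [NeZero L] (x : Fin (d + 1) → ℤ) (a : Fib d) : |ctGen d α L κ' u x a| ≤ 1 + ell (d + 1) L := by
  rcases a with β | μ
  · exact (abs_ctGen_inl_le α L κ' u x β).trans (le_add_of_nonneg_right (by positivity))
  · exact (abs_ctGen_inr_le α L κ' u x μ).trans (le_add_of_nonneg_left zero_le_one)

/-- [folklore] **FINITE RANGE** of the generator: it vanishes at legs `x` with `u − x ∉ cube (2L)` (`L ≥ 1`). -/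
theorem ctGen_eq_zero_of_not_mem_cube [NeZero L] {x : Fin (d + 1) → ℤ} (hx : u - x ∉ cube (d + 1) (2 * L)) (a : Fib d) :
    ctGen d α L κ' u x a = 0 := by
  rcases a with β | μ
  · rw [ctGen_inl]
    split_ifs with h
    · exfalso
      refine hx ?_
      rw [h.1, sub_self]
      exact AxialDressingRooted.zero_mem_cube _
    · rfl
  · rw [ctGen_inr]
    split_ifs with h
    · rw [neg_eq_zero]
      have hproj : Torus.proj L x = 0 := (off_eq_zero_iff_proj x).1 h.2
      have e := linAvgAt_delta1_eq_pow_mul_linKerAt (L := L) (ctr (d + 1) L) κ' u μ (blk L x)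
      have hL : (L : ℝ) ^ (d + 1) ≠ 0 := pow_ne_zero _ (by exact_mod_cast NeZero.ne L)
      have hz : linAvgAt (ctr (d + 1) L) (delta1 κ' u) L μ (blk L x) = 0 := by
        rw [AveragingContoursRooted.ctr]
        refine linAvgAt_delta1_eq_zero_of_not_near (ctrOff_mem_box (one_le_of_neZero L)) κ' μ fun hnear => hx ?_
        rw [blk_eq_quo] at hnear
        exact sub_mem_cube_of_near hproj hnear
      rw [hz] at e
      exact (mul_eq_zero.1 e.symm).resolve_left hL
    · rfl

/-- [folklore] The constant of the contact's bi-localisation. -/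
def cCT (d L : ℕ) (δ : ℝ) : ℝ := (1 + ell (d + 1) L) * Real.exp (δ * (((d : ℝ) + 1) * (4 * L)))

/-- [folklore] `0 ≤ cCT`. -/
theorem cCT_nonneg (d L : ℕ) (δ : ℝ) : 0 ≤ cCT d L δ := by unfold cCT; positivity

/-- [folklore] **THE DIAGONAL CONTACT IS BI-LOCALISED AT ITS JET BOND**: `BiLoc (diagK (ctGen d α L κ′ u)) u u (cCT d L δ) δ`, `δ ≥ 0`, `L ≥ 1`. -/
theorem biLoc_diagK_ctGen [NeZero L] {δ : ℝ} (hδ : 0 ≤ δ) : BiLoc (diagK (ctGen d α L κ' u)) u u (cCT d L δ) δ := by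
  classical
  intro x y a b
  have hnn : 0 ≤ cCT d L δ * Real.exp (-δ * (l1 (x - u) + l1 (y - u))) := mul_nonneg (cCT_nonneg d L δ) (Real.exp_pos _).le
  rw [diagK_apply]
  split_ifs with h
  · obtain ⟨rfl, rfl⟩ := h
    by_cases hx : u - x ∈ cube (d + 1) (2 * L)
    · have hl : l1 (x - u) ≤ ((d : ℝ) + 1) * (2 * L) := by
        rw [ExpKernelCalculus.l1_sub_symm]
        have := l1_le_of_mem_cube hx
        push_cast at this
        linarith
      have h0 : 0 ≤ l1 (x - u) := l1_nonneg _
      calc |ctGen d α L κ' u x a| ≤ (1 + ell (d + 1) L) * 1 := by rw [mul_one]; exact abs_ctGen_le α L κ' u x a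
        _ ≤ (1 + ell (d + 1) L) * (Real.exp (δ * (((d : ℝ) + 1) * (4 * L))) * Real.exp (-δ * (l1 (x - u) + l1 (x - u)))) := by
            refine mul_le_mul_of_nonneg_left ?_ (by positivity)
            rw [← Real.exp_add]
            exact Real.one_le_exp (by nlinarith)
        _ = cCT d L δ * Real.exp (-δ * (l1 (x - u) + l1 (x - u))) := by unfold cCT; ring
    · rw [ctGen_eq_zero_of_not_mem_cube α L κ' u hx, abs_zero]
      exact hnn
  · rw [abs_zero]; exact hnn

/-- [folklore] **THE SOCKET `hC` FOR THE `j = 0` CONTACT FAMILY**: for every scalar `c`, axis `α` and `δ ≥ 0`,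
`LocStencil (fun κ′ u => c • diagK (ctGen d α L κ′ u)) (|c| · cCT d L δ) δ`. -/
theorem locStencil_smul_diagK_ctGen [NeZero L] (c : ℝ) {δ : ℝ} (hδ : 0 ≤ δ) :
    LocStencil (fun κ'' u' => c • diagK (ctGen d α L κ'' u')) (|c| * cCT d L δ) δ := by
  intro κ'' u' x y a b
  show |(c • diagK (ctGen d α L κ'' u')) x y a b| ≤ _
  rw [Pi.smul_apply, Pi.smul_apply, Pi.smul_apply, Pi.smul_apply, smul_eq_mul, abs_mul, mul_assoc]
  exact mul_le_mul_of_nonneg_left (biLoc_diagK_ctGen α L κ'' u' hδ x y a b) (abs_nonneg c)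

end

end Summit.QuantumFields.BalabanUV.Beta.BorderedHessian
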